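import Summits.QuantumFields.BalabanUV.Beta.GAN24.LegPushDressedBoundBlockL1
import Summits.QuantumFields.BalabanUV.Beta.GAN24.LegChainPushDressed
import Summits.QuantumFields.BalabanUV.Beta.GAN24.CarrierKernelLegBottomKernel
import Summits.QuantumFields.BalabanUV.Beta.GAN24.CarrierSlotLegBottomKernelRate
import Summits.QuantumFields.BalabanUV.Beta.GAN24.StepDifferenceInterpolation
import Summits.QuantumFields.BalabanUV.Beta.GAN24.TransportMarginal

/-!
# `BalabanUV.Beta.GAN24.NaturalWindowDrift` — binder row G-an2-4 ∕ (CONV-C), W-slot, the (α-0) parity re-cut, located crux (Q-L-k₀), the DRIFT rows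
# (leaf-03 g68 FILE 4 `LegRowsOfWindows` ∕ FILE 5 `WrecAtEvenHalfRowsOfWindows`: the binder `HΔw`; OWNER `b2b-balaban-gan24-p1` gen 38, part 12 — THE SOCKET CALL 6b₂):
# **(H1Δw) — THE DRIFT WINDOWS OF THE DRESSED COMB LEG CHAIN: `((AΔ·C + BΔ·g)·ν^l, δD)` FOR EVERY LEVEL `l` AND EVERY LENGTH `q < k₀`, THE RATES FIXED BEFORE `k₀`.**

NOT IN PRINT; OUR BOOKKEEPING ([folklore] assembly BY NAME: leaf-01 g74's window `LegPushDressedBoundBlockL1.locStencil₂_legChain_bsumPow_of_dressed_envelopes_of_blockL1` fed with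
MY part 8a `CarrierKernelLegBottomKernel.exists_kChain_bottomKernel_blockMass` (kernel legs of the swapped family `update K♮ᴱ p M`) and MY part 8b′
`CarrierSlotLegBottomKernelRate.exists_dressed_slotLeg_bottomKernel_envelopes_rate` (its slot legs, `φ := 0`, ONE rate for every length), leaf-01's pin
`LegChainPushDressed.abs_prod_kcPin_le`; then leaf-01 g75's cubic interpolation `StepDifferenceInterpolation.locStencil₂_stepDiff_of_rerooted_windows` over MY part 7
`DressedStepDifferenceRows.exists_dressedStep_rows` (`Decays (K♮ᴱ_{l+1} − K♮ᴱ_l) (cK·θ^l) δK`); 0 `def`, 0 cited facts, 0 `def … : Prop`, 0 sorry).  HONEST FRAMING (cell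
contract, verbatim): «discharging `BetaPertH` makes Bałaban's UV stability UNCONDITIONAL — a real constructive-QFT result; it is NOT the continuum limit and NOT the Clay
problem.»  HONEST DEPENDENCY (verbatim): «continuum YM on T⁴ ⇐ BetaPertH ∧ nine spine estimates (0/9 proved); BetaPertH ⇐ (D1) ∧ (D4) ∧ CAP+tail; G-an2-4 gates asym, D1 and
NE2/3/4.»

WHAT (`d = 3`, `2 ≤ Lc`, the (α-0) pin `|c| ≤ Lc^{2(d+1)}`, `K♮ᴱ_j := unitK (sfStep Lc j) (smStep 3 Lc j) (coDressKBmAt (toSite rr) Lc (KInvStep Lc j))`, `kc _ := −(c·Lc^{2(d+1)}·(Lc^{d+1})⁻¹)`):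
* §1 **`rerooted_window_two_rates`** — for the SWAPPED family `update K♮ᴱ p M` (`Decays M CB δK`, `δK` = part 7's rate, ANY `CB ≥ 0`): ONE leg rate `κΔ > 0` (8a's `κ₁` ∧ 8b′'s `κ₈`,
  chosen BEFORE the length) such that for all rates `0 < δ`, `0 < δD` with `18(d+1)·δD ≤ κΔ` and every length `q+1` with the gap `108(d+1)·δD ≤ δ·Lc^{q+1}` there are `Aq, Bq ≥ 0`
  (chosen BEFORE the root, the level, the kernel `M` and the table) with: `W` bounded, `LocStencil₂ W C δ`, the five slot rows at `(g, δ)` ⟹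
  `LocStencil₂ (legChain kc (update K♮ᴱ p M) Lc p (q+1) (bsumPow Lc (q+1) ∘ W)) (Aq·C + Bq·g) δD` — MY part 6b's `window_two_rates` for the swapped family.
* §2 **`rerooted_short_windows`** — for every `k₀` ONE pair `(A, B)` serving every `q < k₀` (finite sums), the gap from `108(d+1)·δD ≤ δ·Lc`.
* §3 **`drift_windows_of_dressed_comb`** = THE `HΔw` BINDER of leaf-03's (Q-L) END with `GoodL :=` the five slot rows:
  `∃ κΔ ν, 0 < κΔ ∧ 0 ≤ ν < 1 ∧ ∀ δ δD, 0 < δD ≤ δ → 18(d+1)·δD ≤ κΔ → 108(d+1)·δD ≤ δ·Lc → ∀ k₀, ∃ AΔ BΔ ≥ 0, ∀ rr l q W C g, q < k₀ → … →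
  LocStencil₂ (legChain kc K♮ᴱ Lc (l+2) q (bsumPow Lc q ∘ (legStepB kc K♮ᴱ Lc (l+1) W − legStepB kc K♮ᴱ Lc l W))) ((AΔ·C + BΔ·g)·ν^l) δD` — four §2-windows of the re-rooted
  families `update K♮ᴱ (l+1) (K♮ᴱ_l + j•Δ̂_l)`, `j ≤ 3`, `Δ̂_l := s_l⁻¹•(K♮ᴱ_{l+1} − K♮ᴱ_l)`, `s_l := (cK∕C₁)·θ^l ∈ [0,1]`, `C₁ := cK + C + 1` (so `Decays Δ̂_l C₁ δK` and
  `Decays (K♮ᴱ_l + j•Δ̂_l) (C + 3C₁) δK`, uniformly in `l`), fed to leaf-01 g75's `locStencil₂_stepDiff_of_rerooted_windows`; `ν := θ`, `AΔ := 7(cK∕C₁)·A`, `BΔ := 7(cK∕C₁)·B`.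
THE RATE ORDER (journal INFO [GAN24P1-G38-ONLINE]): `κΔ` and `ν` are chosen before `(δ, δD)`, which are chosen before `k₀` — the order leaf-03's FILE 5 needs (`H1D` at `(k₀, δD)` forces
`k₀ ≥ kmin(δD)`).  NOT (Q-L) (the END picks `(δS, δ, δD, k₀)` and needs (H1♮)∕(H1w)∕(H1D)∕(HwD), the source ∕ slaved rows, (C)sym too); NEVER «G-an2-4 closed» as (CONV-C); NOT D1, NOT
`BetaPertH`, NOT continuum, NOT Clay; not in print.  Unit `b2b-balaban-gan24-p1` (BINDER row G-an2-4 OWNER; CRUX PROVER on C-R8° CT-ROUTE), gen 38, 2026-08-23.  v1.1 (gen 43, 2026-08-24): one blank line before the final `end` dropped (399 lines ≤ the gate cap with margin) — code byte-identical to v1 3738a4c0cfabc1fc. -/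

noncomputable section

open Finset
open scoped BigOperators
open Literature.MathematicalPhysics.QuantumFieldTheory
open Literature.MathematicalPhysics.QuantumFieldTheory.LatticeForm (quo)
open Literature.MathematicalPhysics.QuantumFieldTheory.Balaban1983to89
open Literature.MathematicalPhysics.QuantumFieldTheory.Balaban1983to89.Beta
open B4ContourShift (supNorm supNorm_nonneg)
open B6BondElimination (unitVec)
open B12Sec2to5 (l1 l1_nonneg)
open ExpKernelCalculus (MKer Decays Zl Zl_nonneg Zl_pos)
open OneStepResolventKernel (Fib)
open OneStepKernelFamily (KInvStep colH)
open AffineAveraging (Site box toSite)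
open BalabanCompositeJets (LocStencil₂ LocStencil₂.nonneg)
open Summit.QuantumFields.BalabanUV.Beta.HessKerDressedUnits (unitK)
open Summit.QuantumFields.BalabanUV.Beta.AxialDressingRooted (coDressKBmAt)
open Summit.QuantumFields.BalabanUV.Beta.GAN24.CombesThomas (sfStep smStep)
open Summit.QuantumFields.BalabanUV.Beta.GAN24.BiStencilZeroMode (Tab)
open Summit.QuantumFields.BalabanUV.Beta.GAN24.Lin4LegTowerUnroll (bsumPow legStepB)
open Summit.QuantumFields.BalabanUV.Beta.GAN24.TransportMarginal (locStencil₂_weaken)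
open Summit.QuantumFields.BalabanUV.Beta.GAN24.LegStepPush (krow)
open Summit.QuantumFields.BalabanUV.Beta.GAN24.LegChainPush (kChain)
open Summit.QuantumFields.BalabanUV.Beta.GAN24.LegChainPushDressed (abs_prod_kcPin_le)
open Summit.QuantumFields.BalabanUV.Beta.GAN24.LegPushDressedBoundBlockL1 (locStencil₂_legChain_bsumPow_of_dressed_envelopes_of_blockL1)
open Summit.QuantumFields.BalabanUV.Beta.GAN24.CarrierKernelLegBottomKernel (exists_kChain_bottomKernel_blockMass)
open Summit.QuantumFields.BalabanUV.Beta.GAN24.CarrierSlotLegBottomKernelRate (exists_dressed_slotLeg_bottomKernel_envelopes_rate)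
open Summit.QuantumFields.BalabanUV.Beta.GAN24.DressedStepDifferenceRows (exists_dressedStep_rows)
open Summit.QuantumFields.BalabanUV.Beta.GAN24.StepDifferenceInterpolation (locStencil₂_stepDiff_of_rerooted_windows)

namespace Summit.QuantumFields.BalabanUV.Beta.GAN24.NaturalWindowDrift

variable {Lc : ℕ} [NeZero Lc]

/-! ## §1 The window of the swapped family at two rates -/

/-- NOT IN PRINT; OUR BOOKKEEPING.  **THE SWAPPED FAMILY's WINDOW AT TWO RATES** (as displayed in the module docstring): family `update K♮ᴱ p M` with `Decays M CB δK`; rate-in `δ`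
(table class and slot rows), rate-out `δD` (`κ₀ := 18(d+1)·δD ≤ κΔ`), length `q+1` with `108(d+1)·δD ≤ δ·Lc^{q+1}`; constants `Aq, Bq ≥ 0` uniform in the root, the level, the
kernel `M` and the table. -/
theorem rerooted_window_two_rates (hLc : 2 ≤ Lc) {c : ℝ} (hc : |c| ≤ (Lc : ℝ) ^ (2 * (3 + 1))) {δK : ℝ} (hδK : 0 < δK) {CB : ℝ} (hCB : 0 ≤ CB) :
    ∃ κΔ : ℝ, 0 < κΔ ∧ ∀ δ δD : ℝ, 0 < δ → 0 < δD → 18 * (((3 : ℕ) : ℝ) + 1) * δD ≤ κΔ → ∀ q : ℕ,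
      ∃ Aq Bq : ℝ, 0 ≤ Aq ∧ 0 ≤ Bq ∧ (108 * (((3 : ℕ) : ℝ) + 1) * δD ≤ δ * (Lc : ℝ) ^ (q + 1) →
        ∀ (rr : Fin (3 + 1) → ℕ), rr ∈ box (3 + 1) Lc → ∀ (p : ℕ) (M : MKer (3 + 1) (Fib 3)), Decays M CB δK → ∀ (W : Tab 3) (C g : ℝ),
          (∃ B : ℝ, ∀ κ u κ' u' x z a b, |W κ u κ' u' x z a b| ≤ B) → LocStencil₂ W C δ →
          (∀ (κ₁ : Fin (3 + 1)) (v : Site (3 + 1)) (κ₂ : Fin (3 + 1)) (x p : Site (3 + 1)) (f b : Fib 3),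
              |∑' v', W κ₁ v κ₂ v' x p f b| ≤ g * Real.exp (-δ * (l1 (x - v) + l1 (p - v)))) →
          (∀ (κ₁ κ₂ : Fin (3 + 1)) (v' x p : Site (3 + 1)) (f b : Fib 3),
              |∑' v, W κ₁ v κ₂ v' x p f b| ≤ g * Real.exp (-δ * (l1 (x - v') + l1 (p - v')))) →
          (∀ (κ₁ κ₂ : Fin (3 + 1)) (x p : Site (3 + 1)) (f b : Fib 3),
              |∑' v, ∑' v', W κ₁ v κ₂ v' x p f b| ≤ g * Real.exp (-δ * l1 (p - x))) →
          (∀ (κ : Fin (3 + 1)) (v w x p : Site (3 + 1)) (f b : Fib 3),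
              |∑ μ, (W κ v μ (w - unitVec μ) x p f b - W κ v μ w x p f b)|
                ≤ g * Real.exp (-δ * l1 (w - v)) * Real.exp (-δ * (l1 (x - v) + l1 (p - v)))) →
          (∀ (κ' : Fin (3 + 1)) (w v' x p : Site (3 + 1)) (f b : Fib 3),
              |∑ κ, (W κ (w - unitVec κ) κ' v' x p f b - W κ w κ' v' x p f b)|
                ≤ g * Real.exp (-δ * l1 (v' - w)) * Real.exp (-δ * (l1 (x - w) + l1 (p - w)))) →
          LocStencil₂
            (Lin4LegTowerUnroll.legChain (fun _ : ℕ => -((c * (Lc : ℝ) ^ (2 * (3 + 1))) * ((Lc : ℝ) ^ (3 + 1))⁻¹))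
              (Function.update (fun j => unitK (sfStep Lc j) (smStep 3 Lc j) (coDressKBmAt (toSite rr) Lc (KInvStep (d := 3) Lc j))) p M) Lc p (q + 1)
              (fun κ u κ' u' => bsumPow Lc (q + 1) (W κ u κ' u')))
            (Aq * C + Bq * g) δD) := by
  classical
  have hLc1 : 1 ≤ Lc := le_trans (by norm_num) hLc
  have hLpos : (0 : ℝ) < (Lc : ℝ) := by exact_mod_cast (show 0 < Lc by omega)
  -- the natural family's rows (part 7), the kernel legs (8a) and the slot legs (8b′) of the swapped family
  obtain ⟨CK, cK, θ, δ7, hδ7, -, -, hCK, -, hrows⟩ := exists_dressedStep_rows (Lc := Lc) hLc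
  obtain ⟨κa, K₈, hκa, hK₈, hBM⟩ := exists_kChain_bottomKernel_blockMass (Lc := Lc) hLc hδK
  obtain ⟨κb, hκb, h8⟩ := exists_dressed_slotLeg_bottomKernel_envelopes_rate (Lc := Lc) hLc hδK
  refine ⟨min κa κb, lt_min hκa hκb, ?_⟩
  intro δ δD hδ hδD hδκ q
  obtain ⟨a₈, ha₈, hENV⟩ := h8 q
  set κ₀ : ℝ := 18 * (((3 : ℕ) : ℝ) + 1) * δD with hκ₀
  have hκ₀0 : 0 < κ₀ := by positivity
  have hκ₀a : κ₀ ≤ κa := hδκ.trans (min_le_left _ _)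
  have hκ₀b : κ₀ ≤ κb := hδκ.trans (min_le_right _ _)
  have hexp : ∀ {κ : ℝ} (s : ℝ), 0 ≤ s → κ₀ ≤ κ → Real.exp (-(κ * s)) ≤ Real.exp (-(κ₀ * s)) := fun s hs hκ => by
    rw [Real.exp_le_exp]; nlinarith
  have hZ6 := Zl_nonneg (D := 3 + 1) (show 0 < δ / 6 by positivity)
  have hZ12 := Zl_nonneg (D := 3 + 1) (show 0 < δ / 6 / 2 by positivity)
  have hZ2 := Zl_nonneg (D := 3 + 1) (show 0 < δ / 2 by positivity)
  have hZκ := Zl_nonneg (D := 3 + 1) (show 0 < κ₀ / (2 * (((3 : ℕ) : ℝ) + 1)) by positivity)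
  set X : ℝ := 2 / (δ / 6) * Zl (3 + 1) (δ / 6 / 2) with hX
  have hX0 : 0 ≤ X := by rw [hX]; positivity
  set Lr : ℝ := (Lc : ℝ) ^ (q + 1) with hLr
  have hLr0 : 0 < Lr := by rw [hLr]; positivity
  have hLcast : (((Lc ^ (q + 1) : ℕ) : ℝ)) = Lr := by rw [hLr, Nat.cast_pow]
  -- the legs' sizes: `a := CB·a₈`, `a′ := CB·a₈·(e^{κb}+1)`, `aφ := 0`, `aρ·L^{d+1} := CB·K₈·(q+1)`
  set a : ℝ := CB * a₈ with ha
  set a' : ℝ := CB * a₈ * (Real.exp κb + 1) with ha'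
  set aρ : ℝ := CB * K₈ * ((q : ℝ) + 1) * ((((Lc ^ (q + 1) : ℕ) : ℝ)) ^ (3 + 1))⁻¹ with haρ
  have ha0 : 0 ≤ a := by rw [ha]; positivity
  have ha'0 : 0 ≤ a' := by rw [ha']; positivity
  have haρ0 : 0 ≤ aρ := by rw [haρ]; positivity
  set P : ℝ := (((Lc ^ (q + 1) : ℕ) : ℝ)) ^ (3 * (3 + 1)) with hP
  have hP0 : 0 ≤ P := by rw [hP]; positivity
  set Aq : ℝ := P * ((Fintype.card (Fib 3) : ℝ) * (((3 : ℕ) : ℝ) + 1) ^ 2 *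
      (aρ * ((Real.exp κ₀ * Zl (3 + 1) (δ / 6)) * (a' ^ 2 * Real.exp κ₀ ^ 2 * X ^ 2)) *
        ((((Lc ^ (q + 1) : ℕ) : ℝ)) ^ (3 + 1) * Zl (3 + 1) (κ₀ / (2 * (((3 : ℕ) : ℝ) + 1)))))) with hAq
  have hAq0 : 0 ≤ Aq := by rw [hAq]; positivity
  set Bq : ℝ := P * ((Fintype.card (Fib 3) : ℝ) * (((3 : ℕ) : ℝ) + 1) ^ 2 *
      (aρ * ((Real.exp κ₀ * Zl (3 + 1) (δ / 6)) * (2 * (a * a' * Real.exp κ₀ * X) + a ^ 2)) *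
        ((((Lc ^ (q + 1) : ℕ) : ℝ)) ^ (3 + 1) * Zl (3 + 1) (κ₀ / (2 * (((3 : ℕ) : ℝ) + 1)))))
      + (Fintype.card (Fib 3) : ℝ) * (aρ * ((((3 : ℕ) : ℝ) + 1) * (2 * (a * 0) + 0 * 0 * (Real.exp δ ^ 3 + 1))) *
        (Real.exp κ₀ ^ 5 * Zl (3 + 1) (δ / 2) ^ 3 * ((((Lc ^ (q + 1) : ℕ) : ℝ)) ^ (3 + 1) * Zl (3 + 1) (κ₀ / (2 * (((3 : ℕ) : ℝ) + 1))))))) with hBq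
  have hBq0 : 0 ≤ Bq := by rw [hBq]; positivity
  refine ⟨Aq, Bq, hAq0, hBq0, ?_⟩
  intro hgapq rr hrr p M hM W C g hB hW hq₂ hq₁ hq₁₂ hD₂ hD₁
  obtain ⟨B, hWb⟩ := hB
  have hg : 0 ≤ g := by
    have h := hq₁₂ 0 0 0 0 (Sum.inl 0) (Sum.inl 0)
    exact (mul_nonneg_iff_of_pos_right (Real.exp_pos _)).1 ((abs_nonneg _).trans h)
  have hC0 : 0 ≤ C := hW.nonneg
  have hgap : κ₀ ≤ δ / 6 * ((Lc ^ (q + 1) : ℕ) : ℝ) := by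
    rw [hLcast]
    have h6 : κ₀ = 108 * (((3 : ℕ) : ℝ) + 1) * δD / 6 := by rw [hκ₀]; ring
    rw [h6, show δ / 6 * Lr = δ * Lr / 6 by ring]
    exact div_le_div_of_nonneg_right hgapq (by norm_num)
  -- the family's levelwise decay
  have hKdec : ∀ j, ∃ C' m : ℝ, 0 < m ∧ Decays (Function.update (fun j => unitK (sfStep Lc j) (smStep 3 Lc j)
      (coDressKBmAt (toSite rr) Lc (KInvStep (d := 3) Lc j))) p M j) C' m := by
    intro j
    by_cases hj : j = p
    · subst hj; exact ⟨CB, δK, hδK, by rw [Function.update_self]; exact hM⟩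
    · exact ⟨CK, δ7, hδ7, by rw [Function.update_of_ne hj]; exact (hrows rr hrr).1 j⟩
  -- the slot legs: `r` itself, `φ := 0`
  have hE : Push4Iter.legChain (fun j => colH (Function.update (fun j => unitK (sfStep Lc j) (smStep 3 Lc j)
        (coDressKBmAt (toSite rr) Lc (KInvStep (d := 3) Lc j))) p M j) Lc) p q
      = fun μ y κ v => Push4Iter.legChain (fun j => colH (Function.update (fun j => unitK (sfStep Lc j) (smStep 3 Lc j)
          (coDressKBmAt (toSite rr) Lc (KInvStep (d := 3) Lc j))) p M j) Lc) p q μ y κ v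
        + ((fun (_ : Fin (3 + 1)) (_ _ : Site (3 + 1)) => (0 : ℝ)) μ y (v + unitVec κ) - (fun (_ : Fin (3 + 1)) (_ _ : Site (3 + 1)) => (0 : ℝ)) μ y v) := by
    funext μ y κ v; simp
  have hr : ∀ (μ : Fin (3 + 1)) (y : Site (3 + 1)) (κ : Fin (3 + 1)) (v : Site (3 + 1)),
      |Push4Iter.legChain (fun j => colH (Function.update (fun j => unitK (sfStep Lc j) (smStep 3 Lc j)
          (coDressKBmAt (toSite rr) Lc (KInvStep (d := 3) Lc j))) p M j) Lc) p q μ y κ v|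
        ≤ a * Real.exp (-(κ₀ * supNorm (quo (Lc ^ (q + 1)) v - y))) := fun μ y κ v =>
    ((hENV rr hrr M CB hCB hM p μ y κ v).1).trans (by rw [ha]; exact mul_le_mul_of_nonneg_left (hexp _ (supNorm_nonneg _) hκ₀b) (by positivity))
  have hr' : ∀ (μ : Fin (3 + 1)) (y : Site (3 + 1)) (κ : Fin (3 + 1)) (v : Site (3 + 1)) (i : Fin (3 + 1)),
      |Push4Iter.legChain (fun j => colH (Function.update (fun j => unitK (sfStep Lc j) (smStep 3 Lc j)
          (coDressKBmAt (toSite rr) Lc (KInvStep (d := 3) Lc j))) p M j) Lc) p q μ y κ (v + Pi.single i 1)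
        - Push4Iter.legChain (fun j => colH (Function.update (fun j => unitK (sfStep Lc j) (smStep 3 Lc j)
          (coDressKBmAt (toSite rr) Lc (KInvStep (d := 3) Lc j))) p M j) Lc) p q μ y κ v|
        ≤ a' * Real.exp (-(κ₀ * supNorm (quo (Lc ^ (q + 1)) v - y))) := fun μ y κ v i =>
    ((hENV rr hrr M CB hCB hM p μ y κ v).2 i).trans (by rw [ha']; exact mul_le_mul_of_nonneg_left (hexp _ (supNorm_nonneg _) hκ₀b) (by positivity))
  have hφ : ∀ (μ : Fin (3 + 1)) (y v : Site (3 + 1)),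
      |(fun (_ : Fin (3 + 1)) (_ _ : Site (3 + 1)) => (0 : ℝ)) μ y v| ≤ 0 * Real.exp (-(κ₀ * supNorm (quo (Lc ^ (q + 1)) v - y))) := by
    intro μ y v; simp
  -- the kernel legs in block mass (8a)
  have hl₁ : ∀ (α : Fin (3 + 1)) (x' : Site (3 + 1)) (f : Fib 3) (c' : Site (3 + 1)),
      ∑ t ∈ box (3 + 1) (Lc ^ (q + 1)),
          |kChain (fun j => krow (Function.update (fun j => unitK (sfStep Lc j) (smStep 3 Lc j) (coDressKBmAt (toSite rr) Lc (KInvStep (d := 3) Lc j))) p M j) Lc)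
              p q α x' f (((Lc ^ (q + 1) : ℕ) : ℤ) • c' + toSite t)|
        ≤ aρ * (((Lc ^ (q + 1) : ℕ) : ℝ)) ^ (3 + 1) * Real.exp (-(κ₀ * supNorm (c' - x'))) := by
    intro α x' f c'
    refine (hBM rr hrr M CB hCB (fun x y a' b' => hM x y a' b') p q α x' f c').trans ?_
    have e : aρ * (((Lc ^ (q + 1) : ℕ) : ℝ)) ^ (3 + 1) = CB * K₈ * ((q : ℝ) + 1) := by
      rw [haρ]
      have hne : (((Lc ^ (q + 1) : ℕ) : ℝ)) ^ (3 + 1) ≠ 0 := by rw [hLcast]; positivity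
      field_simp
    rw [e]
    exact mul_le_mul_of_nonneg_left (hexp _ (supNorm_nonneg _) hκ₀a) (by positivity)
  -- the window
  have R := locStencil₂_legChain_bsumPow_of_dressed_envelopes_of_blockL1 (d := 3)
    (K := Function.update (fun j => unitK (sfStep Lc j) (smStep 3 Lc j) (coDressKBmAt (toSite rr) Lc (KInvStep (d := 3) Lc j))) p M)
    (kc := fun _ : ℕ => -((c * (Lc : ℝ) ^ (2 * (3 + 1))) * ((Lc : ℝ) ^ (3 + 1))⁻¹))
    (r := Push4Iter.legChain (fun j => colH (Function.update (fun j => unitK (sfStep Lc j) (smStep 3 Lc j)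
          (coDressKBmAt (toSite rr) Lc (KInvStep (d := 3) Lc j))) p M j) Lc) p q)
    (φ := fun (_ : Fin (3 + 1)) (_ _ : Site (3 + 1)) => (0 : ℝ))
    hLc1 hKdec hW hδ p q (L := Lc ^ (q + 1)) rfl hκ₀0 hgap
    ha0 ha'0 le_rfl haρ0 hg hg hE hr hr' hφ hl₁ hWb hq₂ hq₁ hq₁₂ hD₂ hD₁
  have hpin := abs_prod_kcPin_le (d := 3) hLc1 hc p q
  refine locStencil₂_weaken R ?_ ?_
  · refine (mul_le_mul_of_nonneg_right hpin (by positivity)).trans (le_of_eq ?_)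
    rw [hAq, hBq, hP, hX]
    ring
  · have : δD = κ₀ / 3 / (6 * (((3 : ℕ) : ℝ) + 1)) := by rw [hκ₀]; field_simp; ring
    exact this.le

/-! ## §2 Every length `< k₀` at one pair of constants -/

/-- NOT IN PRINT; OUR BOOKKEEPING.  **THE SWAPPED FAMILY's SHORT WINDOWS, ONE PAIR OF CONSTANTS FOR EVERY LENGTH `q+1 ≤ k₀`** (finite sums of §1's constants; the gap of every
length from `108(d+1)·δD ≤ δ·Lc`). -/
theorem rerooted_short_windows (hLc : 2 ≤ Lc) {c : ℝ} (hc : |c| ≤ (Lc : ℝ) ^ (2 * (3 + 1))) {δK : ℝ} (hδK : 0 < δK) {CB : ℝ} (hCB : 0 ≤ CB) :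
    ∃ κΔ : ℝ, 0 < κΔ ∧ ∀ δ δD : ℝ, 0 < δ → 0 < δD → 18 * (((3 : ℕ) : ℝ) + 1) * δD ≤ κΔ → 108 * (((3 : ℕ) : ℝ) + 1) * δD ≤ δ * (Lc : ℝ) →
      ∀ k₀ : ℕ, ∃ A B : ℝ, 0 ≤ A ∧ 0 ≤ B ∧ ∀ (rr : Fin (3 + 1) → ℕ), rr ∈ box (3 + 1) Lc → ∀ (p q : ℕ) (M : MKer (3 + 1) (Fib 3)), q < k₀ → Decays M CB δK →
        ∀ (W : Tab 3) (C g : ℝ),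
          (∃ B' : ℝ, ∀ κ u κ' u' x z a b, |W κ u κ' u' x z a b| ≤ B') → LocStencil₂ W C δ →
          (∀ (κ₁ : Fin (3 + 1)) (v : Site (3 + 1)) (κ₂ : Fin (3 + 1)) (x p : Site (3 + 1)) (f b : Fib 3),
              |∑' v', W κ₁ v κ₂ v' x p f b| ≤ g * Real.exp (-δ * (l1 (x - v) + l1 (p - v)))) →
          (∀ (κ₁ κ₂ : Fin (3 + 1)) (v' x p : Site (3 + 1)) (f b : Fib 3),
              |∑' v, W κ₁ v κ₂ v' x p f b| ≤ g * Real.exp (-δ * (l1 (x - v') + l1 (p - v')))) →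
          (∀ (κ₁ κ₂ : Fin (3 + 1)) (x p : Site (3 + 1)) (f b : Fib 3),
              |∑' v, ∑' v', W κ₁ v κ₂ v' x p f b| ≤ g * Real.exp (-δ * l1 (p - x))) →
          (∀ (κ : Fin (3 + 1)) (v w x p : Site (3 + 1)) (f b : Fib 3),
              |∑ μ, (W κ v μ (w - unitVec μ) x p f b - W κ v μ w x p f b)|
                ≤ g * Real.exp (-δ * l1 (w - v)) * Real.exp (-δ * (l1 (x - v) + l1 (p - v)))) →
          (∀ (κ' : Fin (3 + 1)) (w v' x p : Site (3 + 1)) (f b : Fib 3),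
              |∑ κ, (W κ (w - unitVec κ) κ' v' x p f b - W κ w κ' v' x p f b)|
                ≤ g * Real.exp (-δ * l1 (v' - w)) * Real.exp (-δ * (l1 (x - w) + l1 (p - w)))) →
          LocStencil₂
            (Lin4LegTowerUnroll.legChain (fun _ : ℕ => -((c * (Lc : ℝ) ^ (2 * (3 + 1))) * ((Lc : ℝ) ^ (3 + 1))⁻¹))
              (Function.update (fun j => unitK (sfStep Lc j) (smStep 3 Lc j) (coDressKBmAt (toSite rr) Lc (KInvStep (d := 3) Lc j))) p M) Lc p (q + 1)
              (fun κ u κ' u' => bsumPow Lc (q + 1) (W κ u κ' u')))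
            (A * C + B * g) δD := by
  classical
  have hLpos : (0 : ℝ) < (Lc : ℝ) := by exact_mod_cast (lt_of_lt_of_le (by norm_num) hLc)
  have hL1 : (1 : ℝ) ≤ Lc := by exact_mod_cast (le_trans (by norm_num) hLc)
  obtain ⟨κΔ, hκΔ, hwin⟩ := rerooted_window_two_rates (Lc := Lc) hLc hc hδK hCB
  refine ⟨κΔ, hκΔ, ?_⟩
  intro δ δD hδ hδD hδκ hgap1 k₀
  have hq := hwin δ δD hδ hδD hδκ
  choose Af Bf hAf hBf hW using hq
  refine ⟨∑ q ∈ Finset.range k₀, Af q, ∑ q ∈ Finset.range k₀, Bf q, Finset.sum_nonneg fun q _ => hAf q, Finset.sum_nonneg fun q _ => hBf q, ?_⟩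
  intro rr hrr p q M hqk hM W C g hB hWS hq₂ hq₁ hq₁₂ hD₂ hD₁
  have hg : 0 ≤ g := by
    have h := hq₁₂ 0 0 0 0 (Sum.inl 0) (Sum.inl 0)
    exact (mul_nonneg_iff_of_pos_right (Real.exp_pos _)).1 ((abs_nonneg _).trans h)
  have hC0 : 0 ≤ C := hWS.nonneg
  have hgapq : 108 * (((3 : ℕ) : ℝ) + 1) * δD ≤ δ * (Lc : ℝ) ^ (q + 1) := by
    refine hgap1.trans ?_
    rw [pow_succ]
    have : (Lc : ℝ) ≤ (Lc : ℝ) ^ q * Lc := le_mul_of_one_le_left hLpos.le (one_le_pow₀ hL1)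
    exact mul_le_mul_of_nonneg_left this hδ.le
  have R := hW q hgapq rr hrr p M hM W C g hB hWS hq₂ hq₁ hq₁₂ hD₂ hD₁
  refine locStencil₂_weaken R ?_ le_rfl
  have h1 := mul_le_mul_of_nonneg_right (Finset.single_le_sum (f := Af) (fun q _ => hAf q) (Finset.mem_range.2 hqk)) hC0
  have h2 := mul_le_mul_of_nonneg_right (Finset.single_le_sum (f := Bf) (fun q _ => hBf q) (Finset.mem_range.2 hqk)) hg
  linarith

/-! ## §3 The drift windows: four re-rooted windows and the cubic interpolation -/

/-- NOT IN PRINT; OUR BOOKKEEPING.  **(H1Δw): THE DRIFT WINDOWS OF THE DRESSED COMB LEG CHAIN** (as displayed in the module docstring) — leaf-03 FILE 4 ∕ FILE 5's binder `HΔw` with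
`GoodL :=` the five slot rows, the rates `(δ → δD)` and `ν` fixed BEFORE `k₀`. -/
theorem drift_windows_of_dressed_comb (hLc : 2 ≤ Lc) {c : ℝ} (hc : |c| ≤ (Lc : ℝ) ^ (2 * (3 + 1))) :
    ∃ κΔ ν : ℝ, 0 < κΔ ∧ 0 ≤ ν ∧ ν < 1 ∧ ∀ δ δD : ℝ, 0 < δD → δD ≤ δ → 18 * (((3 : ℕ) : ℝ) + 1) * δD ≤ κΔ → 108 * (((3 : ℕ) : ℝ) + 1) * δD ≤ δ * (Lc : ℝ) →
      ∀ k₀ : ℕ, ∃ AΔ BΔ : ℝ, 0 ≤ AΔ ∧ 0 ≤ BΔ ∧ ∀ (rr : Fin (3 + 1) → ℕ), rr ∈ box (3 + 1) Lc → ∀ (l q : ℕ) (W : Tab 3) (C g : ℝ), q < k₀ →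
          (∃ B : ℝ, ∀ κ u κ' u' x z a b, |W κ u κ' u' x z a b| ≤ B) → LocStencil₂ W C δ →
          (∀ (κ₁ : Fin (3 + 1)) (v : Site (3 + 1)) (κ₂ : Fin (3 + 1)) (x p : Site (3 + 1)) (f b : Fib 3),
              |∑' v', W κ₁ v κ₂ v' x p f b| ≤ g * Real.exp (-δ * (l1 (x - v) + l1 (p - v)))) →
          (∀ (κ₁ κ₂ : Fin (3 + 1)) (v' x p : Site (3 + 1)) (f b : Fib 3),
              |∑' v, W κ₁ v κ₂ v' x p f b| ≤ g * Real.exp (-δ * (l1 (x - v') + l1 (p - v')))) →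
          (∀ (κ₁ κ₂ : Fin (3 + 1)) (x p : Site (3 + 1)) (f b : Fib 3),
              |∑' v, ∑' v', W κ₁ v κ₂ v' x p f b| ≤ g * Real.exp (-δ * l1 (p - x))) →
          (∀ (κ : Fin (3 + 1)) (v w x p : Site (3 + 1)) (f b : Fib 3),
              |∑ μ, (W κ v μ (w - unitVec μ) x p f b - W κ v μ w x p f b)|
                ≤ g * Real.exp (-δ * l1 (w - v)) * Real.exp (-δ * (l1 (x - v) + l1 (p - v)))) →
          (∀ (κ' : Fin (3 + 1)) (w v' x p : Site (3 + 1)) (f b : Fib 3),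
              |∑ κ, (W κ (w - unitVec κ) κ' v' x p f b - W κ w κ' v' x p f b)|
                ≤ g * Real.exp (-δ * l1 (v' - w)) * Real.exp (-δ * (l1 (x - w) + l1 (p - w)))) →
          LocStencil₂
            (Lin4LegTowerUnroll.legChain (fun _ : ℕ => -((c * (Lc : ℝ) ^ (2 * (3 + 1))) * ((Lc : ℝ) ^ (3 + 1))⁻¹))
              (fun j => unitK (sfStep Lc j) (smStep 3 Lc j) (coDressKBmAt (toSite rr) Lc (KInvStep (d := 3) Lc j))) Lc (l + 2) q
              (fun κ u κ' u' => bsumPow Lc q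
                ((legStepB (fun _ : ℕ => -((c * (Lc : ℝ) ^ (2 * (3 + 1))) * ((Lc : ℝ) ^ (3 + 1))⁻¹))
                    (fun j => unitK (sfStep Lc j) (smStep 3 Lc j) (coDressKBmAt (toSite rr) Lc (KInvStep (d := 3) Lc j))) Lc (l + 1) W
                  - legStepB (fun _ : ℕ => -((c * (Lc : ℝ) ^ (2 * (3 + 1))) * ((Lc : ℝ) ^ (3 + 1))⁻¹))
                    (fun j => unitK (sfStep Lc j) (smStep 3 Lc j) (coDressKBmAt (toSite rr) Lc (KInvStep (d := 3) Lc j))) Lc l W) κ u κ' u')))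
            ((AΔ * C + BΔ * g) * ν ^ l) δD := by
  classical
  -- part 7: the natural family's decay row and its geometric step differences, root-uniform
  obtain ⟨CK, cK, θ, δK, hδK, hθ0, hθ1, hCK, hcK, hrows⟩ := exists_dressedStep_rows (Lc := Lc) hLc
  set C₁ : ℝ := cK + CK + 1 with hC₁
  have hC₁0 : 0 < C₁ := by rw [hC₁]; linarith
  have hcKC₁ : cK / C₁ ≤ 1 := by rw [div_le_one hC₁0, hC₁]; linarith
  have hcK0' : 0 ≤ cK / C₁ := div_nonneg hcK hC₁0.le
  set CB : ℝ := CK + 3 * C₁ with hCB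
  have hCB0 : 0 ≤ CB := by rw [hCB]; positivity
  obtain ⟨κΔ, hκΔ, hsw⟩ := rerooted_short_windows (Lc := Lc) hLc hc hδK hCB0
  refine ⟨κΔ, θ, hκΔ, hθ0, hθ1, ?_⟩
  intro δ δD hδD hδDδ hδκ hgap1 k₀
  have hδ : 0 < δ := lt_of_lt_of_le hδD hδDδ
  obtain ⟨A, B, hA, hB, hwin⟩ := hsw δ δD hδ hδD hδκ hgap1 k₀
  refine ⟨7 * (cK / C₁) * A, 7 * (cK / C₁) * B, by positivity, by positivity, ?_⟩
  intro rr hrr l q W C g hqk hBW hW hq₂ hq₁ hq₁₂ hD₂ hD₁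
  obtain ⟨hKrow, hKdiff⟩ := hrows rr hrr
  have hg : 0 ≤ g := by
    have h := hq₁₂ 0 0 0 0 (Sum.inl 0) (Sum.inl 0)
    exact (mul_nonneg_iff_of_pos_right (Real.exp_pos _)).1 ((abs_nonneg _).trans h)
  have hC0 : 0 ≤ C := hW.nonneg
  -- the normalisation that isolates `θ^l`
  set s : ℝ := cK / C₁ * θ ^ l with hs
  have hs0 : 0 ≤ s := by rw [hs]; positivity
  have hs1 : s ≤ 1 := by rw [hs]; exact mul_le_one₀ hcKC₁ (pow_nonneg hθ0 l) (pow_le_one₀ hθ0 hθ1.le)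
  have hsC₁ : s * C₁ = cK * θ ^ l := by rw [hs]; field_simp
  set Δ : MKer (3 + 1) (Fib 3) := s⁻¹ • (unitK (sfStep Lc (l + 1)) (smStep 3 Lc (l + 1)) (coDressKBmAt (toSite rr) Lc (KInvStep (d := 3) Lc (l + 1)))
      - unitK (sfStep Lc l) (smStep 3 Lc l) (coDressKBmAt (toSite rr) Lc (KInvStep (d := 3) Lc l))) with hΔ
  have hD := hKdiff l 1
  -- `Decays Δ C₁ δK`
  have hΔdec : Decays Δ C₁ δK := by
    intro x y a b
    have h1 := hD x y a b
    simp only [hΔ, Pi.smul_apply, smul_eq_mul, abs_mul]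
    have hinv : |s⁻¹| * (cK * θ ^ l) ≤ C₁ := by
      by_cases hz : s = 0
      · rw [hz, inv_zero, abs_zero, zero_mul]; exact hC₁0.le
      · rw [abs_of_nonneg (inv_nonneg.2 hs0), ← hsC₁, ← mul_assoc, inv_mul_cancel₀ hz, one_mul]
    calc |s⁻¹| * |(unitK (sfStep Lc (l + 1)) (smStep 3 Lc (l + 1)) (coDressKBmAt (toSite rr) Lc (KInvStep (d := 3) Lc (l + 1)))
              - unitK (sfStep Lc l) (smStep 3 Lc l) (coDressKBmAt (toSite rr) Lc (KInvStep (d := 3) Lc l))) x y a b|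
        ≤ |s⁻¹| * (cK * θ ^ l * Real.exp (-δK * l1 (x - y))) := mul_le_mul_of_nonneg_left h1 (abs_nonneg _)
      _ = |s⁻¹| * (cK * θ ^ l) * Real.exp (-δK * l1 (x - y)) := by ring
      _ ≤ C₁ * Real.exp (-δK * l1 (x - y)) := mul_le_mul_of_nonneg_right hinv (Real.exp_pos _).le
  -- `K♮ᴱ_{l+1} = K♮ᴱ_l + s • Δ`
  have hstep : (fun j => unitK (sfStep Lc j) (smStep 3 Lc j) (coDressKBmAt (toSite rr) Lc (KInvStep (d := 3) Lc j))) (l + 1)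
      = (fun j => unitK (sfStep Lc j) (smStep 3 Lc j) (coDressKBmAt (toSite rr) Lc (KInvStep (d := 3) Lc j))) l + s • Δ := by
    by_cases hz : s = 0
    · -- `cK·θ^l = 0`: consecutive kernels coincide
      have h0 : cK * θ ^ l = 0 := by rw [← hsC₁, hz, zero_mul]
      rw [hz, zero_smul, add_zero]
      funext x y a b
      have h1 := hD x y a b
      rw [h0, zero_mul] at h1
      have h2 : (unitK (sfStep Lc (l + 1)) (smStep 3 Lc (l + 1)) (coDressKBmAt (toSite rr) Lc (KInvStep (d := 3) Lc (l + 1)))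
          - unitK (sfStep Lc l) (smStep 3 Lc l) (coDressKBmAt (toSite rr) Lc (KInvStep (d := 3) Lc l))) x y a b = 0 :=
        abs_nonpos_iff.1 h1
      have h3 : unitK (sfStep Lc (l + 1)) (smStep 3 Lc (l + 1)) (coDressKBmAt (toSite rr) Lc (KInvStep (d := 3) Lc (l + 1))) x y a b
          - unitK (sfStep Lc l) (smStep 3 Lc l) (coDressKBmAt (toSite rr) Lc (KInvStep (d := 3) Lc l)) x y a b = 0 := by
        simpa only [Pi.sub_apply] using h2
      show unitK (sfStep Lc (l + 1)) (smStep 3 Lc (l + 1)) (coDressKBmAt (toSite rr) Lc (KInvStep (d := 3) Lc (l + 1))) x y a b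
        = unitK (sfStep Lc l) (smStep 3 Lc l) (coDressKBmAt (toSite rr) Lc (KInvStep (d := 3) Lc l)) x y a b
      linarith
    · rw [hΔ, smul_smul, mul_inv_cancel₀ hz, one_smul]
      show unitK (sfStep Lc (l + 1)) (smStep 3 Lc (l + 1)) (coDressKBmAt (toSite rr) Lc (KInvStep (d := 3) Lc (l + 1)))
        = unitK (sfStep Lc l) (smStep 3 Lc l) (coDressKBmAt (toSite rr) Lc (KInvStep (d := 3) Lc l))
          + (unitK (sfStep Lc (l + 1)) (smStep 3 Lc (l + 1)) (coDressKBmAt (toSite rr) Lc (KInvStep (d := 3) Lc (l + 1)))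
            - unitK (sfStep Lc l) (smStep 3 Lc l) (coDressKBmAt (toSite rr) Lc (KInvStep (d := 3) Lc l)))
      abel
  -- the four re-rooted bottom kernels decay with `CB = C + 3C₁`, uniformly in `l`
  have hMdec : ∀ j : ℕ, j ≤ 3 → Decays ((fun j => unitK (sfStep Lc j) (smStep 3 Lc j) (coDressKBmAt (toSite rr) Lc (KInvStep (d := 3) Lc j))) l + (j : ℝ) • Δ) CB δK := by
    intro j hj x y a b
    have h1 := hKrow l x y a b
    have h2 := hΔdec x y a b
    have hj3 : (j : ℝ) ≤ 3 := by exact_mod_cast hj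
    have hj0 : (0 : ℝ) ≤ j := Nat.cast_nonneg j
    have hE0 : 0 ≤ Real.exp (-δK * l1 (x - y)) := (Real.exp_pos _).le
    simp only [Pi.add_apply, Pi.smul_apply, smul_eq_mul]
    calc |unitK (sfStep Lc l) (smStep 3 Lc l) (coDressKBmAt (toSite rr) Lc (KInvStep (d := 3) Lc l)) x y a b + (j : ℝ) * Δ x y a b|
        ≤ |unitK (sfStep Lc l) (smStep 3 Lc l) (coDressKBmAt (toSite rr) Lc (KInvStep (d := 3) Lc l)) x y a b| + |(j : ℝ) * Δ x y a b| := abs_add_le _ _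
      _ ≤ CK * Real.exp (-δK * l1 (x - y)) + (j : ℝ) * (C₁ * Real.exp (-δK * l1 (x - y))) := by
          rw [abs_mul, abs_of_nonneg hj0]; exact add_le_add h1 (mul_le_mul_of_nonneg_left h2 hj0)
      _ ≤ CK * Real.exp (-δK * l1 (x - y)) + 3 * (C₁ * Real.exp (-δK * l1 (x - y))) := by
          have : 0 ≤ C₁ * Real.exp (-δK * l1 (x - y)) := by positivity
          nlinarith
      _ = CB * Real.exp (-δK * l1 (x - y)) := by rw [hCB]; ring
  -- the natural family decays levelwise (for the interpolation letter)
  have hKnat : ∀ n, ∃ δ' C' : ℝ, 0 < δ' ∧ Decays ((fun j => unitK (sfStep Lc j) (smStep 3 Lc j) (coDressKBmAt (toSite rr) Lc (KInvStep (d := 3) Lc j))) n) C' δ' :=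
    fun n => ⟨δK, CK, hδK, hKrow n⟩
  -- the four windows
  have h4 : ∀ j : ℕ, j ≤ 3 → LocStencil₂
      (Lin4LegTowerUnroll.legChain (fun _ : ℕ => -((c * (Lc : ℝ) ^ (2 * (3 + 1))) * ((Lc : ℝ) ^ (3 + 1))⁻¹))
        (Function.update (fun j => unitK (sfStep Lc j) (smStep 3 Lc j) (coDressKBmAt (toSite rr) Lc (KInvStep (d := 3) Lc j))) (l + 1)
          ((fun j => unitK (sfStep Lc j) (smStep 3 Lc j) (coDressKBmAt (toSite rr) Lc (KInvStep (d := 3) Lc j))) l + (j : ℝ) • Δ)) Lc (l + 1) (q + 1)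
        (fun κ u κ' u' => bsumPow Lc (q + 1) (W κ u κ' u'))) (A * C + B * g) δD :=
    fun j hj => hwin rr hrr (l + 1) q _ hqk (hMdec j hj) W C g hBW hW hq₂ hq₁ hq₁₂ hD₂ hD₁
  -- the cubic interpolation (leaf-01 g75)
  have R := locStencil₂_stepDiff_of_rerooted_windows (d := 3) (N := Lc)
    (kc := fun _ : ℕ => -((c * (Lc : ℝ) ^ (2 * (3 + 1))) * ((Lc : ℝ) ^ (3 + 1))⁻¹))
    (Kf := fun j => unitK (sfStep Lc j) (smStep 3 Lc j) (coDressKBmAt (toSite rr) Lc (KInvStep (d := 3) Lc j)))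
    hKnat (l := l) rfl q hBW hΔdec hδK hs0 hs1 hstep h4
  refine locStencil₂_weaken R (le_of_eq ?_) le_rfl
  rw [hs]; ring

end Summit.QuantumFields.BalabanUV.Beta.GAN24.NaturalWindowDrift
end
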